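import Literature.Combinatorics.Enumerative.BaileyChainAndrewsIdentity
import Literature.Combinatorics.Enumerative.BalancedFourFThreeTransformations
import HarnessLib

/-!
# The confluent Bailey chain: Andrews' identity with one (or more) unpaired parameter (`c → ∞`)

Topic `Combinatorics/Enumerative`, namespace `Literature.Combinatorics.Enumerative.BaileyChain` (continuation of
`BaileyChainAndrewsIdentity.lean`). Everything is PROVED over an arbitrary commutative ring; no named facts.

Krattenthaler–Rivoal use their Théorèmes 8 and 9 (Andrews' identity and its Sears/Whipple iterate) also "avec
`c → ∞`" for one of the parameter pairs: [KrattenthalerRivoal2007, §9, proof of Corollaire 2] ("on pose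
`m = (A+1)/2+B`, … et finalement on fait tendre `c₁` vers `∞`"), [§10, proof of Corollaire 4] ("on fait tendre `c_B`
vers `∞`") and [§10, proof of Corollaire 6] ("on fait tendre `c₁` vers `∞`") — this is how the case of ODD `A` of
their Théorème 1 is reached: an unpaired numerator parameter `b` contributes `(b)_k (−1)^k/(1+a−b)_k` to the
very-well-poised summand (the limit of `(b)_k(c)_k/((1+a−b)_k(1+a−c)_k)` as `c → ∞`), so the series has an odd
number of parameter pairs and argument `−1`. In the Bailey-chain proof (AAR §12.2) the corresponding step is
Bailey's lemma with `ρ₂ → ∞`, whose inner evaluation is Chu–Vandermonde instead of Pfaff–Saalschütz.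

This file formalises the chain with LINKS `(b, some c)` (a full pair) or `(b, none)` (an unpaired `b`), in the
denominator-free normalisation of `BaileyChainAndrewsIdentity.lean`:

* `linkTailProd`, `linkHeadProd`, `linkPairSum`, `linkStep` (= `tailProd`, `headProd`, `pairSum`, `baileyStep` with
  links: an unpaired `b` contributes `(1+A−b+k)_m` to the running product and `(b)_k(−1)^k` to the numerator product);
* `halfStep A b L β n = Σ_{i≤n} (−1)^i C(n,i) (1+A+2i)_{2(n−i)} (b)_i ∏_L(…) β i` — the confluent Bailey step, and
  **`halfLemma`**: `halfStep A b L (linkPairSum A L α̂) n = linkPairSum A ((b,none)::L) (k ↦ (−1)^k (b)_k α̂ k) n`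
  (Bailey's lemma with `ρ₂ → ∞`; inner sum = Chu–Vandermonde, `halfKeySum`);
* `linkBaileyLemma` (the full step, as before), `linkVwpSum`, `linkMultiSum` and **`andrews_link`**:
  `linkVwpSum A L n = linkMultiSum A L n` for every link list — Théorème 8 "avec des `c_j → ∞`";
* `linkVwpSum_map_some`, `linkMultiSum_map_some`: on lists of full pairs these are `vwpSum`, `multiSum`;
* `linkVwpSum_perm/swap/repair/repair_none`, `linkMultiSum_perm`: symmetries in the parameters;
* `reducedMultiSum`/`linkReducedMultiSum`, **`multiSum_eq_reduced`**, `linkMultiSum_eq_reduced`: the very-well-poised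
  factors telescope, `multiSum A L n = A (1+A)_{2n} · reducedMultiSum A L n` (at KR's `a = 2ε−n` this is the factor
  `(2ε−n)_n · 2ε · (1+2ε)_n` — the `ε` of "`S = ε·s`");
* `linkMultiSum_cons_cons`, **`link_theoreme9`**, `linkVwpSum_eq_theoreme9`: Théorème 9 (the Sears-transformed
  two-level unfolding, `BalancedFourFThreeTransformations.lean`) over link lists — "Théorème 9 avec `c_B → ∞`".

## References
* [KrattenthalerRivoal2007] C. Krattenthaler, T. Rivoal, Mem. AMS 186 (2007), §6 Thm 8, §9 proof of Cor. 2,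
  §10 proofs of Cor. 4 and 6 (arXiv:math/0311114 pp. 12, 21–23).
* [AndrewsAskeyRoy1999] G. E. Andrews, R. Askey, R. Roy, *Special Functions*, CUP 1999, §12.2 (Bailey's lemma,
  Thm 12.2.3) and §2.2 Cor. 2.2.3 (Chu–Vandermonde).
-/

namespace Literature.Combinatorics.Enumerative

namespace BaileyChain

open Finset

/-! ### Exchanging a triangular double sum -/

/-- `Σ_{i≤n} Σ_{k≤i} f i k = Σ_{k≤n} Σ_{j≤n−k} f (k+j) k`. [folklore] -/
private theorem sum_triangle {M : Type*} [AddCommMonoid M] (f : ℕ → ℕ → M) (n : ℕ) :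
    ∑ i ∈ range (n + 1), ∑ k ∈ range (i + 1), f i k =
      ∑ k ∈ range (n + 1), ∑ j ∈ range (n - k + 1), f (k + j) k := by
  induction n with
  | zero => simp
  | succ n ih =>
    have hR : ∑ k ∈ range (n + 1 + 1), ∑ j ∈ range (n + 1 - k + 1), f (k + j) k =
        ∑ k ∈ range (n + 1), ∑ j ∈ range (n - k + 1), f (k + j) k +
          ∑ k ∈ range (n + 1 + 1), f (n + 1) k := by
      rw [sum_range_succ, show n + 1 - (n + 1) + 1 = 1 by omega, sum_range_one, add_zero,
        sum_range_succ (fun k => f (n + 1) k)]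
      have h : ∑ k ∈ range (n + 1), ∑ j ∈ range (n + 1 - k + 1), f (k + j) k =
          ∑ k ∈ range (n + 1), (∑ j ∈ range (n - k + 1), f (k + j) k + f (n + 1) k) := by
        refine sum_congr rfl fun k hk => ?_
        have hk' : k ≤ n := Nat.lt_succ_iff.mp (mem_range.mp hk)
        rw [show n + 1 - k + 1 = (n - k + 1) + 1 by omega, sum_range_succ,
          show k + (n - k + 1) = n + 1 by omega]
      rw [h, sum_add_distrib, add_assoc]
    rw [sum_range_succ, ih, hR]

variable {R : Type*} [CommRing R]

/-! ### Rising factorials (private shorthand) -/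

/-- The rising factorial `(z)_m = z(z+1)⋯(z+m−1)` (private shorthand). [folklore] -/
private def pw (z : R) (m : ℕ) : R := ∏ i ∈ range m, (z + i)

/-- Unfolding of the shorthand `pw`. [folklore] -/
private theorem pw_def (z : R) (m : ℕ) : pw z m = ∏ i ∈ range m, (z + i) := rfl

/-- `(z)_{m+1} = (z)_m (z+m)`. [folklore] -/
private theorem pw_succ (z : R) (m : ℕ) : pw z (m + 1) = pw z m * (z + m) := by
  simp [pw, prod_range_succ]

/-- `(z)_{m+1} = z (z+1)_m`. [folklore] -/
private theorem pw_succ_left (z : R) (m : ℕ) : pw z (m + 1) = z * pw (z + 1) m := by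
  induction m with
  | zero => simp [pw]
  | succ m ih =>
    rw [pw_succ, ih, pw_succ]
    push_cast
    ring

/-- `(z)_{m₁+m₂} = (z)_{m₁} (z+m₁)_{m₂}`. [folklore] -/
private theorem pw_add (z : R) (m₁ m₂ : ℕ) : pw z (m₁ + m₂) = pw z m₁ * pw (z + m₁) m₂ := by
  simp only [pw, prod_range_add]
  congr 1
  refine prod_congr rfl fun i _ => ?_
  push_cast
  ring

/-- Congruence of `pw` in its base. [folklore] -/
private theorem pw_congr {z z' : R} (h : z = z') (m : ℕ) : pw z m = pw z' m := by rw [h]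

/-! ### Chu–Vandermonde: the inner summation of the confluent step -/

/-- Chu–Vandermonde in the form `Σ_{j≤N} (−1)^j C(N,j) (x)_j (y+j)_{N−j} = (y−x)_N` (`pw` shorthand).
[cite: AndrewsAskeyRoy1999, §2.2 Cor. 2.2.3 (Chu–Vandermonde)] -/
private theorem halfKeySum_pw (x y : R) (N : ℕ) :
    ∑ j ∈ range (N + 1), (-1 : R) ^ j * (N.choose j : R) * pw x j * pw (y + j) (N - j) = pw (y - x) N := by
  induction N generalizing x y with
  | zero => simp [pw]
  | succ N ih =>
    rw [sum_range_succ', Nat.choose_zero_right, Nat.cast_one, pow_zero, Nat.sub_zero]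
    -- split `C(N+1, j+1) = C(N, j) + C(N, j+1)`
    have hsplit : ∑ j ∈ range (N + 1), (-1 : R) ^ (j + 1) * ((N + 1).choose (j + 1) : R) * pw x (j + 1) *
        pw (y + ((j + 1 : ℕ) : R)) (N + 1 - (j + 1)) =
        ∑ j ∈ range (N + 1), (-1 : R) ^ (j + 1) * (N.choose j : R) * pw x (j + 1) *
            pw (y + ((j + 1 : ℕ) : R)) (N - j) +
          ∑ j ∈ range (N + 1), (-1 : R) ^ (j + 1) * (N.choose (j + 1) : R) * pw x (j + 1) *
            pw (y + ((j + 1 : ℕ) : R)) (N - j) := by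
      rw [← sum_add_distrib]
      refine sum_congr rfl fun j _ => ?_
      rw [Nat.choose_succ_succ, Nat.cast_add, show N + 1 - (j + 1) = N - j by omega]
      ring
    -- first part: `−x · Σ_j (−1)^j C(N,j) (x+1)_j (y+1+j)_{N−j} = −x (y−x)_N`
    have h1 : ∑ j ∈ range (N + 1), (-1 : R) ^ (j + 1) * (N.choose j : R) * pw x (j + 1) *
        pw (y + ((j + 1 : ℕ) : R)) (N - j) = -x * pw (y - x) N := by
      have h := ih (x + 1) (y + 1)
      rw [show y + 1 - (x + 1) = y - x by ring] at h
      rw [← h, mul_sum]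
      refine sum_congr rfl fun j _ => ?_
      rw [pw_succ_left, pw_congr (show y + ((j + 1 : ℕ) : R) = y + 1 + j by push_cast; ring)]
      ring
    -- second part together with the `j = 0` term: `(y+N) Σ_i (−1)^i C(N,i) (x)_i (y+i)_{N−i}`
    have h2 : ∑ j ∈ range (N + 1), (-1 : R) ^ (j + 1) * (N.choose (j + 1) : R) * pw x (j + 1) *
        pw (y + ((j + 1 : ℕ) : R)) (N - j) + 1 * 1 * pw x 0 * pw (y + ((0 : ℕ) : R)) (N + 1) =
        (y + N) * pw (y - x) N := by
      have h := ih x y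
      -- the sum `Σ_{i ≤ N+1} (−1)^i C(N,i) (x)_i (y+i)_{N+1−i}` written from `i = 0`
      have hfull : ∑ i ∈ range (N + 1 + 1), (-1 : R) ^ i * (N.choose i : R) * pw x i *
          pw (y + i) (N + 1 - i) = (y + N) * pw (y - x) N := by
        rw [sum_range_succ, Nat.choose_succ_self, Nat.cast_zero, mul_zero, zero_mul, zero_mul, add_zero,
          ← h, mul_sum]
        refine sum_congr rfl fun i hi => ?_
        have hi' : i ≤ N := Nat.lt_succ_iff.mp (mem_range.mp hi)
        rw [show N + 1 - i = (N - i) + 1 by omega, pw_succ,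
          show y + (i : R) + ((N - i : ℕ) : R) = y + N by rw [Nat.cast_sub hi']; ring]
        ring
      rw [sum_range_succ'] at hfull
      rw [← hfull]
      congr 1
      · refine sum_congr rfl fun j _ => ?_
        rw [show N + 1 - (j + 1) = N - j by omega]
      · simp [pw]
    rw [hsplit, add_assoc, h2, h1, pw_succ]
    ring

/-- **Chu–Vandermonde** (the inner sum of the confluent Bailey step):
`Σ_{j≤N} (−1)^j C(N,j) (x)_j (y+j)_{N−j} = (y−x)_N`. [cite: AndrewsAskeyRoy1999, §2.2 Cor. 2.2.3 (Chu–Vandermonde)] -/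
theorem halfKeySum (x y : R) (N : ℕ) :
    ∑ j ∈ range (N + 1), (-1 : R) ^ j * (N.choose j : R) * (∏ i ∈ range j, (x + i)) *
        (∏ i ∈ range (N - j), (y + j + i)) = ∏ i ∈ range N, (y - x + i) := by
  have h := halfKeySum_pw x y N
  simp only [pw_def] at h
  exact h

/-! ### Links: full pairs `(b, some c)` and unpaired parameters `(b, none)` -/

/-- Running product of a link list: a full pair `(b, some c)` contributes `(1+A−b+k)_m (1+A−c+k)_m`, an unpaired
`(b, none)` contributes `(1+A−b+k)_m` (the limit of `(1+A−c+k)_m/(−c)^m`, `c → ∞`).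
[cite: KrattenthalerRivoal2007, §9 proof of Corollaire 2 ("on fait tendre c₁ vers ∞")] -/
def linkTailProd (A : R) (L : List (R × Option R)) (k : R) (m : ℕ) : R :=
  (L.map fun l : R × Option R => (∏ i ∈ range m, (1 + A - l.1 + k + (i : R))) *
    l.2.elim 1 (fun c => ∏ i ∈ range m, (1 + A - c + k + (i : R)))).prod

/-- Numerator product of a link list: a full pair contributes `(b)_k (c)_k`, an unpaired `b` contributes
`(b)_k (−1)^k` (the limit of `(b)_k (c)_k/(−c)^k`). [cite: KrattenthalerRivoal2007, §9 proof of Corollaire 2] -/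
def linkHeadProd (L : List (R × Option R)) (k : ℕ) : R :=
  (L.map fun l : R × Option R => (∏ i ∈ range k, (l.1 + (i : R))) *
    l.2.elim ((-1 : R) ^ k) (fun c => ∏ i ∈ range k, (c + (i : R)))).prod

/-- The pair transform relative to a link list (as `pairSum`, with `linkTailProd`).
[cite: AndrewsAskeyRoy1999, §12.2 (12.2.1) and Thm 12.2.3] -/
def linkPairSum (A : R) (L : List (R × Option R)) (α : ℕ → R) (n : ℕ) : R :=
  ∑ k ∈ range (n + 1), (n.choose k : R) * (∏ i ∈ range (n - k), (1 + A + n + k + i)) *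
    linkTailProd A L k (n - k) * α k

/-- One full Bailey step `(b, c)` over a link list (as `baileyStep`, with `linkTailProd`).
[cite: AndrewsAskeyRoy1999, §12.2 (12.2.4)] -/
def linkStep (A b c : R) (L : List (R × Option R)) (β : ℕ → R) (n : ℕ) : R :=
  ∑ i ∈ range (n + 1), (n.choose i : R) * (∏ j ∈ range (2 * (n - i)), (1 + A + 2 * i + j)) *
    (∏ j ∈ range (n - i), (1 + A - b - c + j)) * (∏ j ∈ range i, (b + j)) * (∏ j ∈ range i, (c + j)) *
    linkTailProd A L i (n - i) * β i

/-- One **confluent Bailey step** (unpaired `b`; `c → ∞` in `baileyStep`, i.e. the coefficient of `c^n`, times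
`(−1)^n`): `halfStep A b L β n = Σ_{i≤n} (−1)^i C(n,i) (1+A+2i)_{2(n−i)} (b)_i ∏_L(…) β i`.
[cite: KrattenthalerRivoal2007, §9 proof of Corollaire 2] [cite: AndrewsAskeyRoy1999, §12.2 (12.2.4)] -/
def halfStep (A b : R) (L : List (R × Option R)) (β : ℕ → R) (n : ℕ) : R :=
  ∑ i ∈ range (n + 1), (-1 : R) ^ i * (n.choose i : R) * (∏ j ∈ range (2 * (n - i)), (1 + A + 2 * i + j)) *
    (∏ j ∈ range i, (b + j)) * linkTailProd A L i (n - i) * β i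

/-- Running product of the empty link list. [folklore] -/
private theorem linkTailProd_nil (A : R) (k : R) (m : ℕ) : linkTailProd A [] k m = 1 := by simp [linkTailProd]

/-- Running product of a full pair. [folklore] -/
private theorem linkTailProd_cons_some (A b c : R) (L : List (R × Option R)) (k : R) (m : ℕ) :
    linkTailProd A ((b, some c) :: L) k m = pw (1 + A - b + k) m * pw (1 + A - c + k) m * linkTailProd A L k m := by
  simp only [linkTailProd, List.map_cons, List.prod_cons, Option.elim_some, pw]

/-- Running product of an unpaired parameter. [folklore] -/
private theorem linkTailProd_cons_none (A b : R) (L : List (R × Option R)) (k : R) (m : ℕ) :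
    linkTailProd A ((b, none) :: L) k m = pw (1 + A - b + k) m * linkTailProd A L k m := by
  simp only [linkTailProd, List.map_cons, List.prod_cons, Option.elim_none, mul_one, pw]

/-- Numerator product of the empty link list. [folklore] -/
private theorem linkHeadProd_nil (k : ℕ) : linkHeadProd ([] : List (R × Option R)) k = 1 := by
  simp [linkHeadProd]

/-- Numerator product of a full pair. [folklore] -/
private theorem linkHeadProd_cons_some (b c : R) (L : List (R × Option R)) (k : ℕ) :
    linkHeadProd ((b, some c) :: L) k = pw b k * pw c k * linkHeadProd L k := by
  simp only [linkHeadProd, List.map_cons, List.prod_cons, Option.elim_some, pw]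

/-- Numerator product of an unpaired parameter. [folklore] -/
private theorem linkHeadProd_cons_none (b : R) (L : List (R × Option R)) (k : ℕ) :
    linkHeadProd ((b, none) :: L) k = pw b k * (-1 : R) ^ k * linkHeadProd L k := by
  simp only [linkHeadProd, List.map_cons, List.prod_cons, Option.elim_none, pw]

/-- Gluing the running products along the chain. [folklore] -/
private theorem linkTailProd_glue (A : R) (L : List (R × Option R)) (k j m : ℕ) :
    linkTailProd A L (((k + j : ℕ) : R)) m * linkTailProd A L (k : R) j = linkTailProd A L (k : R) (j + m) := by
  induction L with
  | nil => simp [linkTailProd_nil]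
  | cons l L ih =>
    obtain ⟨b, o⟩ := l
    have e1 : 1 + A - b + ((k + j : ℕ) : R) = 1 + A - b + k + j := by push_cast; ring
    cases o with
    | none =>
      rw [linkTailProd_cons_none, linkTailProd_cons_none, linkTailProd_cons_none, ← ih, pw_add (1 + A - b + k),
        pw_congr e1]
      ring
    | some c =>
      have e2 : 1 + A - c + ((k + j : ℕ) : R) = 1 + A - c + k + j := by push_cast; ring
      rw [linkTailProd_cons_some, linkTailProd_cons_some, linkTailProd_cons_some, ← ih, pw_add (1 + A - b + k),
        pw_add (1 + A - c + k), pw_congr e1, pw_congr e2]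
      ring

/-- Binomials and very-well-poised blocks along one step (`i = k + j`, `n = k + N`):
`C(n,k+j) C(k+j,k) = C(n,k) C(N,j)` and `(1+A+2k+2j)_{2(N−j)} (1+A+2k+j)_j = (1+A+2k+j)_{N−j} (1+A+n+k)_N`.
[cite: AndrewsAskeyRoy1999, §12.2, proof of Thm 12.2.3, pp. 584–585] -/
private theorem stepBlocks (A : R) (k N j : ℕ) (hjN : j ≤ N) :
    ((k + N).choose (k + j) : R) * ((k + j).choose k : R) = ((k + N).choose k : R) * (N.choose j : R) ∧
      pw (1 + A + 2 * ((k + j : ℕ) : R)) (2 * (N - j)) * pw (1 + A + ((k + j : ℕ) : R) + k) j =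
        pw (1 + A + 2 * (k : R) + j) (N - j) * pw (1 + A + ((k + N : ℕ) : R) + k) N := by
  constructor
  · have h := Nat.choose_mul (n := k + N) (k := k + j) (s := k) (by omega)
    rw [Nat.add_sub_cancel_left, Nat.add_sub_cancel_left] at h
    have h' := congrArg (Nat.cast : ℕ → R) h
    push_cast at h'
    exact h'
  · have e1 : pw (1 + A + ((k + j : ℕ) : R) + k) j = pw (1 + A + 2 * (k : R) + j) j :=
      pw_congr (by push_cast; ring) j
    have e2 : pw (1 + A + 2 * ((k + j : ℕ) : R)) (2 * (N - j)) =
        pw (1 + A + 2 * (k : R) + j + j) (2 * (N - j)) := pw_congr (by push_cast; ring) _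
    have e3 : pw (1 + A + ((k + N : ℕ) : R) + k) N =
        pw (1 + A + 2 * (k : R) + j + ((N - j : ℕ) : R)) N :=
      pw_congr (by rw [Nat.cast_sub hjN]; push_cast; ring) N
    rw [e1, e2, e3, mul_comm, ← pw_add, show j + 2 * (N - j) = (N - j) + N by omega, pw_add]

/-- **Bailey's lemma at `q = 1` over a link list** (the full step; as `baileyLemma`).
[cite: AndrewsAskeyRoy1999, §12.2 Thm 12.2.3, pp. 583–585] -/
theorem linkBaileyLemma (A b c : R) (L : List (R × Option R)) (α : ℕ → R) (n : ℕ) :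
    linkStep A b c L (linkPairSum A L α) n =
      linkPairSum A ((b, some c) :: L) (fun k => (∏ i ∈ range k, (b + i)) * (∏ i ∈ range k, (c + i)) * α k) n := by
  simp only [linkStep, linkPairSum, ← pw_def, linkTailProd_cons_some]
  simp_rw [mul_sum]
  rw [sum_triangle]
  refine sum_congr rfl fun k hk => ?_
  obtain ⟨N, rfl⟩ : ∃ N, n = k + N := ⟨n - k, by have := mem_range.mp hk; omega⟩
  simp only [Nat.add_sub_cancel_left, Nat.add_sub_add_left]
  calc _ = ∑ j ∈ range (N + 1),
        (((k + N).choose (k + j) : R) * ((k + j).choose k : R)) *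
          (pw (1 + A + 2 * ((k + j : ℕ) : R)) (2 * (N - j)) * pw (1 + A + ((k + j : ℕ) : R) + k) j) *
          (linkTailProd A L ((k + j : ℕ) : R) (N - j) * linkTailProd A L (k : R) j) *
          pw (1 + A - b - c) (N - j) * pw b (k + j) * pw c (k + j) * α k := by
        refine sum_congr rfl fun j _ => ?_
        ring
    _ = ∑ j ∈ range (N + 1), ((k + N).choose k : R) * pw (1 + A + ((k + N : ℕ) : R) + k) N * pw b k *
          pw c k * linkTailProd A L (k : R) N * α k *
          ((N.choose j : R) * pw (b + k) j * pw (c + k) j * pw (1 + A + 2 * (k : R) + j) (N - j) *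
            pw (1 + A - b - c) (N - j)) := by
        refine sum_congr rfl fun j hj => ?_
        have hjN : j ≤ N := Nat.lt_succ_iff.mp (mem_range.mp hj)
        obtain ⟨hchoose, hvwp⟩ := stepBlocks A k N j hjN
        rw [hchoose, hvwp, linkTailProd_glue, show j + (N - j) = N by omega, pw_add b k j, pw_add c k j]
        ring
    _ = ((k + N).choose k : R) * pw (1 + A + ((k + N : ℕ) : R) + k) N * pw b k * pw c k *
          linkTailProd A L (k : R) N * α k * (pw (1 + A - b + k) N * pw (1 + A - c + k) N) := by
        rw [← mul_sum]
        congr 1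
        have h := keySum A b c k N
        simp only [← pw_def] at h
        exact h
    _ = _ := by ring

/-- **The confluent Bailey lemma** (`ρ₂ → ∞` in AAR Thm 12.2.3; polynomial form): for every sequence `α̂` and
link list `L`, `halfStep A b L (linkPairSum A L α̂) n = linkPairSum A ((b, none) :: L) (k ↦ (−1)^k (b)_k α̂ k) n`.
Proof as for `baileyLemma`: exchange the two finite sums; the inner sum is Chu–Vandermonde (`halfKeySum`) instead
of Pfaff–Saalschütz. [cite: KrattenthalerRivoal2007, §9 proof of Corollaire 2 ("on fait tendre c₁ vers ∞")]
[cite: AndrewsAskeyRoy1999, §12.2 Thm 12.2.3] -/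
theorem halfLemma (A b : R) (L : List (R × Option R)) (α : ℕ → R) (n : ℕ) :
    halfStep A b L (linkPairSum A L α) n =
      linkPairSum A ((b, none) :: L) (fun k => (-1 : R) ^ k * (∏ i ∈ range k, (b + i)) * α k) n := by
  simp only [halfStep, linkPairSum, ← pw_def, linkTailProd_cons_none]
  simp_rw [mul_sum]
  rw [sum_triangle]
  refine sum_congr rfl fun k hk => ?_
  obtain ⟨N, rfl⟩ : ∃ N, n = k + N := ⟨n - k, by have := mem_range.mp hk; omega⟩
  simp only [Nat.add_sub_cancel_left, Nat.add_sub_add_left]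
  calc _ = ∑ j ∈ range (N + 1),
        (-1 : R) ^ (k + j) * (((k + N).choose (k + j) : R) * ((k + j).choose k : R)) *
          (pw (1 + A + 2 * ((k + j : ℕ) : R)) (2 * (N - j)) * pw (1 + A + ((k + j : ℕ) : R) + k) j) *
          (linkTailProd A L ((k + j : ℕ) : R) (N - j) * linkTailProd A L (k : R) j) *
          pw b (k + j) * α k := by
        refine sum_congr rfl fun j _ => ?_
        ring
    _ = ∑ j ∈ range (N + 1), ((k + N).choose k : R) * pw (1 + A + ((k + N : ℕ) : R) + k) N *
          linkTailProd A L (k : R) N * ((-1 : R) ^ k * pw b k * α k) *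
          ((-1 : R) ^ j * (N.choose j : R) * pw (b + k) j * pw (1 + A + 2 * (k : R) + j) (N - j)) := by
        refine sum_congr rfl fun j hj => ?_
        have hjN : j ≤ N := Nat.lt_succ_iff.mp (mem_range.mp hj)
        obtain ⟨hchoose, hvwp⟩ := stepBlocks A k N j hjN
        rw [hchoose, hvwp, linkTailProd_glue, show j + (N - j) = N by omega, pw_add b k j, pow_add]
        ring
    _ = ((k + N).choose k : R) * pw (1 + A + ((k + N : ℕ) : R) + k) N *
          linkTailProd A L (k : R) N * ((-1 : R) ^ k * pw b k * α k) * pw (1 + A - b + k) N := by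
        rw [← mul_sum, halfKeySum_pw, pw_congr (show 1 + A + 2 * (k : R) - (b + k) = 1 + A - b + k by ring)]
    _ = _ := by ring

/-! ### Andrews' identity with unpaired parameters -/

/-- The very-well-poised side over a link list (as `vwpSum`, with `linkHeadProd`, `linkTailProd`): an unpaired
`b` puts `(b)_k (−1)^k (1+A−b+k)_{n−k}` into the summand, i.e. the factor `(b)_k/(1+a−b)_k · (−1)^k` of the
very-well-poised series — the limit `c → ∞` of a pair `(b, c)`.
[cite: KrattenthalerRivoal2007, §6 Théorème 8 with §9 proof of Corollaire 2 (c₁ → ∞)] -/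
def linkVwpSum (A : R) (L : List (R × Option R)) (n : ℕ) : R :=
  ∑ k ∈ range (n + 1), (-1 : R) ^ k * (n.choose k : R) * (A + 2 * k) * (∏ i ∈ range k, (A + i)) *
    (∏ i ∈ range (n - k), (1 + A + n + k + i)) * linkHeadProd L k * linkTailProd A L k (n - k)

/-- The multiple-sum side over a link list: the unit pair at `[]`, a full Bailey step at `(b, some c)`, the
confluent step `halfStep` at `(b, none)`.
[cite: KrattenthalerRivoal2007, §6 Théorème 8 with §9 proof of Corollaire 2 (c₁ → ∞)] -/
def linkMultiSum (A : R) : List (R × Option R) → ℕ → R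
  | [], n => if n = 0 then A else 0
  | (b, some c) :: L, n => linkStep A b c L (fun i => linkMultiSum A L i) n
  | (b, none) :: L, n => halfStep A b L (fun i => linkMultiSum A L i) n

/-- `linkVwpSum` is the pair transform of the very-well-poised weight. [cite: KrattenthalerRivoal2007, §6 Théorème 8] -/
theorem linkVwpSum_eq_pairSum (A : R) (L : List (R × Option R)) (n : ℕ) :
    linkVwpSum A L n = linkPairSum A L
      (fun k => (-1 : R) ^ k * (A + 2 * k) * (∏ i ∈ range k, (A + i)) * linkHeadProd L k) n := by
  simp only [linkVwpSum, linkPairSum]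
  refine sum_congr rfl fun k _ => ?_
  ring

/-- Unfolding at the empty list. [cite: AndrewsAskeyRoy1999, §12.2 (12.2.5)] -/
theorem linkMultiSum_nil (A : R) (n : ℕ) : linkMultiSum A [] n = if n = 0 then A else 0 := by
  rw [linkMultiSum]

/-- Unfolding at a full pair. [cite: KrattenthalerRivoal2007, §6 Théorème 8] -/
theorem linkMultiSum_cons_some (A b c : R) (L : List (R × Option R)) (n : ℕ) :
    linkMultiSum A ((b, some c) :: L) n = linkStep A b c L (linkMultiSum A L) n := by
  rw [linkMultiSum]

/-- Unfolding at an unpaired parameter. [cite: KrattenthalerRivoal2007, §9 proof of Corollaire 2] -/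
theorem linkMultiSum_cons_none (A b : R) (L : List (R × Option R)) (n : ℕ) :
    linkMultiSum A ((b, none) :: L) n = halfStep A b L (linkMultiSum A L) n := by
  rw [linkMultiSum]

/-- **Andrews' identity with unpaired parameters** (Théorème 8 "avec des `c_j → ∞`", polynomial form): for every
link list `L` and every `n`, `linkVwpSum A L n = linkMultiSum A L n`. Induction along the chain from the unit
pair (`unitPair`): a full pair is `linkBaileyLemma`, an unpaired parameter is `halfLemma`.
[cite: KrattenthalerRivoal2007, §6 Théorème 8, §9 proof of Corollaire 2, §10 proofs of Corollaires 4 and 6]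
[cite: AndrewsAskeyRoy1999, §12.2 Thm 12.2.3] -/
theorem andrews_link (A : R) (L : List (R × Option R)) (n : ℕ) : linkVwpSum A L n = linkMultiSum A L n := by
  induction L generalizing n with
  | nil =>
    rw [linkMultiSum_nil, ← unitPair A n, linkVwpSum]
    refine sum_congr rfl fun k _ => ?_
    rw [linkHeadProd_nil, linkTailProd_nil, mul_one, mul_one]
  | cons l L ih =>
    obtain ⟨b, o⟩ := l
    have hfun : linkMultiSum A L = linkPairSum A L
        (fun k => (-1 : R) ^ k * (A + 2 * k) * (∏ i ∈ range k, (A + i)) * linkHeadProd L k) := by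
      funext i
      rw [← ih i, linkVwpSum_eq_pairSum]
    cases o with
    | some c =>
      rw [linkMultiSum_cons_some, hfun, linkBaileyLemma, linkVwpSum_eq_pairSum]
      simp only [linkPairSum]
      refine sum_congr rfl fun k _ => ?_
      rw [linkHeadProd_cons_some]
      simp only [← pw_def]
      ring
    | none =>
      rw [linkMultiSum_cons_none, hfun, halfLemma, linkVwpSum_eq_pairSum]
      simp only [linkPairSum]
      refine sum_congr rfl fun k _ => ?_
      rw [linkHeadProd_cons_none]
      simp only [← pw_def]
      ring

/-! ### Lists of full pairs: back to `vwpSum` / `multiSum` -/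

/-- On full pairs the link running product is `tailProd`. [folklore] -/
private theorem linkTailProd_map_some (A : R) (L : List (R × R)) (k : R) (m : ℕ) :
    linkTailProd A (L.map fun bc => (bc.1, some bc.2)) k m = tailProd A L k m := by
  induction L with
  | nil => simp [linkTailProd, tailProd]
  | cons bc L ih =>
    obtain ⟨b, c⟩ := bc
    simp only [List.map_cons, linkTailProd, tailProd, List.prod_cons, Option.elim_some] at ih ⊢
    rw [ih]

/-- On full pairs the link numerator product is `headProd`. [folklore] -/
private theorem linkHeadProd_map_some (L : List (R × R)) (k : ℕ) :
    linkHeadProd (L.map fun bc => (bc.1, some bc.2)) k = headProd L k := by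
  induction L with
  | nil => simp [linkHeadProd, headProd]
  | cons bc L ih =>
    obtain ⟨b, c⟩ := bc
    simp only [List.map_cons, linkHeadProd, headProd, List.prod_cons, Option.elim_some] at ih ⊢
    rw [ih]

/-- On a list of full pairs, `linkVwpSum` is `vwpSum`. [cite: KrattenthalerRivoal2007, §6 Théorème 8] -/
theorem linkVwpSum_map_some (A : R) (L : List (R × R)) (n : ℕ) :
    linkVwpSum A (L.map fun bc => (bc.1, some bc.2)) n = vwpSum A L n := by
  simp only [linkVwpSum, vwpSum, linkTailProd_map_some, linkHeadProd_map_some]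

/-- On a list of full pairs, `linkMultiSum` is `multiSum`. [cite: KrattenthalerRivoal2007, §6 Théorème 8] -/
theorem linkMultiSum_map_some (A : R) (L : List (R × R)) (n : ℕ) :
    linkMultiSum A (L.map fun bc => (bc.1, some bc.2)) n = multiSum A L n := by
  rw [← andrews_link, ← andrews, linkVwpSum_map_some]

/-! ### Théorème 9 over a link list (the top two pairs full, unpaired parameters further inside) -/

/-- `balFourFThree` in the `pw` shorthand. [cite: KrattenthalerRivoal2007, §6 proof of Théorème 9, (4F3)] -/
private theorem balFourFThree_pw' (x y z e f : R) (n : ℕ) :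
    balFourFThree x y z e f n = ∑ u ∈ range (n + 1), (n.choose u : R) * pw x u * pw y u * pw z u *
      pw (e + f - x - y - z) (n - u) * pw (e + u) (n - u) * pw (f + u) (n - u) := by
  simp only [balFourFThree, pw_def]

/-- Congruence of `balFourFThree` in its five parameters. [folklore] -/
private theorem balFourFThree_congr' {x y z e f x' y' z' e' f' : R} (hx : x = x') (hy : y = y') (hz : z = z')
    (he : e = e') (hf : f = f') (n : ℕ) : balFourFThree x y z e f n = balFourFThree x' y' z' e' f' n := by
  subst hx hy hz he hf; rfl

/-- Two levels of the chain at once over a link list (as `multiSum_cons_cons`): the inner sum over the outer index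
is a terminating balanced `₄F₃`. [cite: KrattenthalerRivoal2007, §6 proof of Théorème 9 (first display)] -/
theorem linkMultiSum_cons_cons (A b c d e : R) (L : List (R × Option R)) (n : ℕ) :
    linkMultiSum A ((b, some c) :: (d, some e) :: L) n =
      ∑ k ∈ range (n + 1), (n.choose k : R) * (∏ j ∈ range (2 * (n - k)), (1 + A + 2 * k + j)) *
        (∏ j ∈ range k, (b + j)) * (∏ j ∈ range k, (c + j)) * (∏ j ∈ range k, (d + j)) * (∏ j ∈ range k, (e + j)) *
        linkTailProd A L k (n - k) * linkMultiSum A L k *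
        balFourFThree (b + k) (c + k) (1 + A - d - e) (1 + A - d + k) (1 + A - e + k) (n - k) := by
  rw [linkMultiSum_cons_some, linkStep]
  simp only [linkMultiSum_cons_some, linkStep, balFourFThree_pw', ← pw_def, mul_sum]
  rw [sum_triangle]
  refine sum_congr rfl fun k hk => ?_
  refine sum_congr rfl fun j hj => ?_
  have hkn : k ≤ n := Nat.lt_succ_iff.mp (mem_range.mp hk)
  obtain ⟨m, rfl⟩ : ∃ m, n = k + j + m := ⟨n - k - j, by have := mem_range.mp hj; omega⟩
  simp only [show k + j + m - (k + j) = m by omega, show k + j + m - k = j + m by omega, Nat.add_sub_cancel_left,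
    show j + m - j = m by omega, linkTailProd_cons_some]
  -- binomials
  have hC : (((k + j + m).choose (k + j) : ℕ) : R) * (((k + j).choose k : ℕ) : R) =
      (((k + j + m).choose k : ℕ) : R) * (((j + m).choose j : ℕ) : R) := by
    have h := Nat.choose_mul (n := k + j + m) (k := k + j) (s := k) (by omega)
    rw [show k + j + m - k = j + m by omega, show k + j - k = j by omega] at h
    have h' := congrArg (Nat.cast : ℕ → R) h
    push_cast at h'
    exact h'
  have hV : pw (1 + A + 2 * (k : R)) (2 * (j + m)) =
      pw (1 + A + 2 * (k : R)) (2 * j) * pw (1 + A + 2 * ((k + j : ℕ) : R)) (2 * m) := by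
    rw [show 2 * (j + m) = 2 * j + 2 * m by ring, pw_add]
    congr 1
    exact pw_congr (by push_cast; ring) _
  have hb : pw b (k + j) = pw b k * pw (b + k) j := pw_add b k j
  have hc : pw c (k + j) = pw c k * pw (c + k) j := pw_add c k j
  have hG := linkTailProd_glue A L k j m
  have hd : pw (1 + A - d + ((k + j : ℕ) : R)) m = pw (1 + A - d + (k : R) + j) m := pw_congr (by push_cast; ring) m
  have he : pw (1 + A - e + ((k + j : ℕ) : R)) m = pw (1 + A - e + (k : R) + j) m := pw_congr (by push_cast; ring) m
  have hσ : pw (1 + A - d + (k : R) + (1 + A - e + (k : R)) - (b + k) - (c + k) - (1 + A - d - e)) m =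
      pw (1 + A - b - c) m := pw_congr (by ring) m
  rw [hV, hb, hc, hd, he, hσ, ← hG]
  linear_combination (pw (1 + A + 2 * (k : R)) (2 * j) * pw (1 + A + 2 * ((k + j : ℕ) : R)) (2 * m) *
    pw (1 + A - b - c) m * (pw b k * pw (b + k) j) * (pw c k * pw (c + k) j) *
    (pw (1 + A - d + (k : R) + j) m * pw (1 + A - e + (k : R) + j) m) *
    pw (1 + A - d - e) j * pw d k * pw e k *
    (linkTailProd A L (((k + j : ℕ) : R)) m * linkTailProd A L (k : R) j) * linkMultiSum A L k) * hC

/-- **Théorème 9 over a link list** ("Théorème 9 avec `c_B → ∞`", as used in [KrattenthalerRivoal2007, §10,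
proofs of Corollaires 4 and 6]): `krattenthalerRivoal_theoreme9` with unpaired parameters allowed below the two
(full) top pairs — the two-level unfolding with its top balanced `₄F₃` transformed by Sears' (4F3).
[cite: KrattenthalerRivoal2007, §6 Théorème 9 with §10 proofs of Corollaires 4 and 6 (arXiv:math/0311114 pp. 12–13, 22–23)] -/
theorem link_theoreme9 (A b c d e : R) (L : List (R × Option R)) (n : ℕ) :
    linkMultiSum A ((b, some c) :: (d, some e) :: L) n =
      ∑ k ∈ range (n + 1), (n.choose k : R) * (∏ j ∈ range (2 * (n - k)), (1 + A + 2 * k + j)) *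
        (∏ j ∈ range k, (b + j)) * (∏ j ∈ range k, (c + j)) * (∏ j ∈ range k, (d + j)) * (∏ j ∈ range k, (e + j)) *
        linkTailProd A L k (n - k) * linkMultiSum A L k *
        balFourFThree (b + k) (b - A - n) (-1 - 2 * A + b + c + d + e - ((n - k : ℕ) : R))
          (b + d - A - ((n - k : ℕ) : R)) (b + e - A - ((n - k : ℕ) : R)) (n - k) := by
  rw [linkMultiSum_cons_cons]
  refine sum_congr rfl fun k hk => ?_
  have hkn : k ≤ n := Nat.lt_succ_iff.mp (mem_range.mp hk)
  rw [balFourFThree_sears (b + k)]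
  congr 1
  refine balFourFThree_congr' rfl ?_ ?_ ?_ ?_ (n - k)
  · rw [Nat.cast_sub hkn]; ring
  · ring
  · ring
  · ring

/-- **Théorème 9 over a link list, very-well-poised form** (`andrews_link`).
[cite: KrattenthalerRivoal2007, §6 Théorème 9 (eq:main) with §10 proofs of Corollaires 4 and 6] -/
theorem linkVwpSum_eq_theoreme9 (A b c d e : R) (L : List (R × Option R)) (n : ℕ) :
    linkVwpSum A ((b, some c) :: (d, some e) :: L) n =
      ∑ k ∈ range (n + 1), (n.choose k : R) * (∏ j ∈ range (2 * (n - k)), (1 + A + 2 * k + j)) *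
        (∏ j ∈ range k, (b + j)) * (∏ j ∈ range k, (c + j)) * (∏ j ∈ range k, (d + j)) * (∏ j ∈ range k, (e + j)) *
        linkTailProd A L k (n - k) * linkMultiSum A L k *
        balFourFThree (b + k) (b - A - n) (-1 - 2 * A + b + c + d + e - ((n - k : ℕ) : R))
          (b + d - A - ((n - k : ℕ) : R)) (b + e - A - ((n - k : ℕ) : R)) (n - k) := by
  rw [andrews_link, link_theoreme9]

/-! ### Symmetries of the very-well-poised side over link lists -/

/-- `linkHeadProd` is invariant under permutations of the links. [cite: KrattenthalerRivoal2007, §6 Théorème 8] -/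
theorem linkHeadProd_perm {L L' : List (R × Option R)} (h : L.Perm L') (k : ℕ) :
    linkHeadProd L k = linkHeadProd L' k :=
  (h.map _).prod_eq

/-- `linkTailProd` is invariant under permutations of the links. [cite: KrattenthalerRivoal2007, §6 Théorème 8] -/
theorem linkTailProd_perm (A : R) {L L' : List (R × Option R)} (h : L.Perm L') (k : R) (m : ℕ) :
    linkTailProd A L k m = linkTailProd A L' k m :=
  (h.map _).prod_eq

/-- The very-well-poised sum over links is invariant under permutations of the links.
[cite: KrattenthalerRivoal2007, §6 Théorème 8] -/
theorem linkVwpSum_perm (A : R) {L L' : List (R × Option R)} (h : L.Perm L') (n : ℕ) :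
    linkVwpSum A L n = linkVwpSum A L' n := by
  unfold linkVwpSum
  refine sum_congr rfl fun k _ => ?_
  rw [linkHeadProd_perm h, linkTailProd_perm A h]

/-- … under exchanging the two parameters of a full pair. [cite: KrattenthalerRivoal2007, §6 Théorème 8] -/
theorem linkVwpSum_swap (A b c : R) (L : List (R × Option R)) (n : ℕ) :
    linkVwpSum A ((b, some c) :: L) n = linkVwpSum A ((c, some b) :: L) n := by
  unfold linkVwpSum
  refine sum_congr rfl fun k _ => ?_
  rw [linkHeadProd_cons_some, linkHeadProd_cons_some, linkTailProd_cons_some, linkTailProd_cons_some]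
  ring

/-- … under re-pairing four parameters `(b,c),(d,e) ↦ (b,d),(c,e)`. [cite: KrattenthalerRivoal2007, §6 Théorème 8] -/
theorem linkVwpSum_repair (A b c d e : R) (L : List (R × Option R)) (n : ℕ) :
    linkVwpSum A ((b, some c) :: (d, some e) :: L) n = linkVwpSum A ((b, some d) :: (c, some e) :: L) n := by
  unfold linkVwpSum
  refine sum_congr rfl fun k _ => ?_
  rw [linkHeadProd_cons_some, linkHeadProd_cons_some, linkHeadProd_cons_some, linkHeadProd_cons_some,
    linkTailProd_cons_some, linkTailProd_cons_some, linkTailProd_cons_some, linkTailProd_cons_some]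
  ring

/-- … under moving a parameter between a full pair and an unpaired link: `(b,c),(d,∞) ↦ (b,d),(c,∞)`.
[cite: KrattenthalerRivoal2007, §6 Théorème 8 with §9 proof of Corollaire 2] -/
theorem linkVwpSum_repair_none (A b c d : R) (L : List (R × Option R)) (n : ℕ) :
    linkVwpSum A ((b, some c) :: (d, none) :: L) n = linkVwpSum A ((b, some d) :: (c, none) :: L) n := by
  unfold linkVwpSum
  refine sum_congr rfl fun k _ => ?_
  rw [linkHeadProd_cons_some, linkHeadProd_cons_some, linkHeadProd_cons_none, linkHeadProd_cons_none,
    linkTailProd_cons_some, linkTailProd_cons_some, linkTailProd_cons_none, linkTailProd_cons_none]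
  ring

/-- **Multisum transformations over links**: `linkMultiSum` is invariant under permutations of the links (by
`andrews_link`). [cite: KrattenthalerRivoal2007, §6 Théorèmes 8–9] -/
theorem linkMultiSum_perm (A : R) {L L' : List (R × Option R)} (h : L.Perm L') (n : ℕ) :
    linkMultiSum A L n = linkMultiSum A L' n := by
  rw [← andrews_link, ← andrews_link, linkVwpSum_perm A h]

/-! ### The very-well-poised factor telescopes out of the chain

In the normalisation of `BaileyChain.multiSum` every Bailey step carries the factor `(1+A+2i)_{2(n−i)}`; along
the chain these glue with the unit pair's `A = A·(1+A)_0` into the single factor `A (1+A)_{2n}`: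
`multiSum A L n = A (1+A)_{2n} · reducedMultiSum A L n`, where the REDUCED multiple sum has the same recursion
without that factor. (In Krattenthaler–Rivoal's Théorème 8 this is the factor `(1+a)_N (1+a+N)_N/(1+a)_{2i_m}·…`
collected over the levels; at their parameters `a = 2ε−n` of §10 it is `(2ε−n)_{2n+1} = (2ε−n)_n · 2ε · (1+2ε)_n` —
the source of the factor `ε` in "`S_{A,B,r}(n) = ε · s_{A,B,r}(n)`" of Corollaires 3–6.) -/

/-- The **reduced multiple sum**: `BaileyChain.multiSum` without the very-well-poised factors `(1+A+2i)_{2(n−i)}`: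
`reducedMultiSum A [] n = [n = 0]`,
`reducedMultiSum A ((b,c)::L) n = Σ_{i≤n} C(n,i) (1+A−b−c)_{n−i} (b)_i (c)_i ∏_L(1+A−b′+i)_{n−i}(1+A−c′+i)_{n−i} · reducedMultiSum A L i`.
[cite: KrattenthalerRivoal2007, §6 Théorème 8 (right-hand side without the factor (1+a)_N-type normalisation); §10] -/
def reducedMultiSum (A : R) : List (R × R) → ℕ → R
  | [], n => if n = 0 then 1 else 0
  | (b, c) :: L, n => ∑ i ∈ range (n + 1), (n.choose i : R) * (∏ j ∈ range (n - i), (1 + A - b - c + j)) *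
      (∏ j ∈ range i, (b + j)) * (∏ j ∈ range i, (c + j)) * tailProd A L i (n - i) * reducedMultiSum A L i

/-- Unfolding at the empty list. [cite: KrattenthalerRivoal2007, §6 Théorème 8] -/
theorem reducedMultiSum_nil (A : R) (n : ℕ) : reducedMultiSum A [] n = if n = 0 then 1 else 0 := by
  rw [reducedMultiSum]

/-- Unfolding at a cons. [cite: KrattenthalerRivoal2007, §6 Théorème 8] -/
theorem reducedMultiSum_cons (A b c : R) (L : List (R × R)) (n : ℕ) :
    reducedMultiSum A ((b, c) :: L) n = ∑ i ∈ range (n + 1), (n.choose i : R) *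
      (∏ j ∈ range (n - i), (1 + A - b - c + j)) * (∏ j ∈ range i, (b + j)) * (∏ j ∈ range i, (c + j)) *
      tailProd A L i (n - i) * reducedMultiSum A L i := by
  rw [reducedMultiSum]

/-- **Telescoping of the very-well-poised factor**: `multiSum A L n = A · (1+A)_{2n} · reducedMultiSum A L n`
((1+A)_{2i} (1+A+2i)_{2(n−i)} = (1+A)_{2n}` level by level, down to the unit pair).
[cite: KrattenthalerRivoal2007, §6 Théorème 8; §10 proof of Corollaire 3] -/
theorem multiSum_eq_reduced (A : R) (L : List (R × R)) (n : ℕ) :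
    multiSum A L n = A * (∏ j ∈ range (2 * n), (1 + A + j)) * reducedMultiSum A L n := by
  induction L generalizing n with
  | nil =>
    rw [multiSum_nil, reducedMultiSum_nil]
    split_ifs with h
    · subst h; simp
    · simp
  | cons bc L ih =>
    obtain ⟨b, c⟩ := bc
    rw [multiSum_cons, baileyStep, reducedMultiSum_cons, mul_sum]
    refine sum_congr rfl fun i hi => ?_
    have hin : i ≤ n := Nat.lt_succ_iff.mp (mem_range.mp hi)
    rw [ih i]
    have htel : (∏ j ∈ range (2 * i), (1 + A + j)) * ∏ j ∈ range (2 * (n - i)), (1 + A + 2 * (i : R) + j) =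
        ∏ j ∈ range (2 * n), (1 + A + j) := by
      rw [← pw_def, ← pw_def, ← pw_def, show 2 * n = 2 * i + 2 * (n - i) by omega, pw_add]
      congr 1
      exact pw_congr (by push_cast; ring) _
    rw [← htel]
    ring

/-- The reduced multiple sum over a link list (as `reducedMultiSum`, with the confluent step reduced to
`Σ_i (−1)^i C(n,i) (b)_i ∏_L(…) · …`). [cite: KrattenthalerRivoal2007, §9 proof of Corollaire 2; §10 proofs of Corollaires 4, 6] -/
def linkReducedMultiSum (A : R) : List (R × Option R) → ℕ → R
  | [], n => if n = 0 then 1 else 0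
  | (b, some c) :: L, n => ∑ i ∈ range (n + 1), (n.choose i : R) * (∏ j ∈ range (n - i), (1 + A - b - c + j)) *
      (∏ j ∈ range i, (b + j)) * (∏ j ∈ range i, (c + j)) * linkTailProd A L i (n - i) * linkReducedMultiSum A L i
  | (b, none) :: L, n => ∑ i ∈ range (n + 1), (-1 : R) ^ i * (n.choose i : R) * (∏ j ∈ range i, (b + j)) *
      linkTailProd A L i (n - i) * linkReducedMultiSum A L i

/-- Unfolding at the empty link list. [cite: KrattenthalerRivoal2007, §6 Théorème 8] -/
theorem linkReducedMultiSum_nil (A : R) (n : ℕ) : linkReducedMultiSum A [] n = if n = 0 then 1 else 0 := by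
  rw [linkReducedMultiSum]

/-- Unfolding at a full pair. [cite: KrattenthalerRivoal2007, §6 Théorème 8] -/
theorem linkReducedMultiSum_cons_some (A b c : R) (L : List (R × Option R)) (n : ℕ) :
    linkReducedMultiSum A ((b, some c) :: L) n = ∑ i ∈ range (n + 1), (n.choose i : R) *
      (∏ j ∈ range (n - i), (1 + A - b - c + j)) * (∏ j ∈ range i, (b + j)) * (∏ j ∈ range i, (c + j)) *
      linkTailProd A L i (n - i) * linkReducedMultiSum A L i := by
  rw [linkReducedMultiSum]

/-- Unfolding at an unpaired parameter. [cite: KrattenthalerRivoal2007, §9 proof of Corollaire 2] -/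
theorem linkReducedMultiSum_cons_none (A b : R) (L : List (R × Option R)) (n : ℕ) :
    linkReducedMultiSum A ((b, none) :: L) n = ∑ i ∈ range (n + 1), (-1 : R) ^ i * (n.choose i : R) *
      (∏ j ∈ range i, (b + j)) * linkTailProd A L i (n - i) * linkReducedMultiSum A L i := by
  rw [linkReducedMultiSum]

/-- **Telescoping over link lists**: `linkMultiSum A L n = A · (1+A)_{2n} · linkReducedMultiSum A L n`.
[cite: KrattenthalerRivoal2007, §6 Théorème 8; §10 proofs of Corollaires 4, 6] -/
theorem linkMultiSum_eq_reduced (A : R) (L : List (R × Option R)) (n : ℕ) :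
    linkMultiSum A L n = A * (∏ j ∈ range (2 * n), (1 + A + j)) * linkReducedMultiSum A L n := by
  induction L generalizing n with
  | nil =>
    rw [linkMultiSum_nil, linkReducedMultiSum_nil]
    split_ifs with h
    · subst h; simp
    · simp
  | cons l L ih =>
    obtain ⟨b, o⟩ := l
    have htel : ∀ i ≤ n, (∏ j ∈ range (2 * i), (1 + A + j)) * ∏ j ∈ range (2 * (n - i)), (1 + A + 2 * (i : R) + j) =
        ∏ j ∈ range (2 * n), (1 + A + j) := fun i hin => by
      rw [← pw_def, ← pw_def, ← pw_def, show 2 * n = 2 * i + 2 * (n - i) by omega, pw_add]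
      congr 1
      exact pw_congr (by push_cast; ring) _
    cases o with
    | some c =>
      rw [linkMultiSum_cons_some, linkStep, linkReducedMultiSum_cons_some, mul_sum]
      refine sum_congr rfl fun i hi => ?_
      rw [ih i, ← htel i (Nat.lt_succ_iff.mp (mem_range.mp hi))]
      ring
    | none =>
      rw [linkMultiSum_cons_none, halfStep, linkReducedMultiSum_cons_none, mul_sum]
      refine sum_congr rfl fun i hi => ?_
      rw [ih i, ← htel i (Nat.lt_succ_iff.mp (mem_range.mp hi))]
      ring

end BaileyChain

end Literature.Combinatorics.Enumerative
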